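import Literature.Topology.FourManifolds.TautFoliationsLevelCircles
import Mathlib.Topology.Homotopy.Basic
import HarnessLib

/-!
# The contour circles around the centres are null-homotopic in their leaves

Topic: sequel to `TautFoliationsLevelCircles.lean`. For the datum of a cone position `P`, the
filled map sends a contour circle `K` of a square `Q` (a compact leaf of the contour
foliation) into the plaque of the box `e_Q` at its level; a plaque is the homeomorphic image of
the convex base `B`, so the map `fill|K : K → L` into the leaf `L` of `F` through the image
(with the subspace topology of `M`) is **homotopic to a constant inside `L`**, by the
straight-line homotopy in box coordinates:

* `ConePosition.fillLeafMap` (**definition**): `fill` on a leaf of the contour foliation, as a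
  continuous map into the leaf of `F` through the image of a base point;
* `ConePosition.homotopic_const_fillLeafMap_levelSet` (**proved**, roof and floor versions):
  on a contour circle it is homotopic to a constant map.

These are the compact leaves, null-homotopic in their leaves, from which the Camacho–Lins Neto
process starts. All statements are [folklore].
-/

noncomputable section

open Set Filter Metric Topology unitInterval
open Literature.Topology.PlanarFoliations

namespace Literature.Topology.FourManifolds

open ConeSquare SquareGrid

namespace Foliation.ConePosition

variable {B : Type*} [NormedAddCommGroup B] [NormedSpace ℝ B] {M : Type*} [TopologicalSpace M]
  {F : Foliation B M} {f : ℝ × ℝ → M} {c₀ : ℝ × ℝ} {L : ℝ} {hL : 0 < L} (P : ConePosition F f c₀ hL)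

/-- **The filled map on a leaf of the contour foliation**, as a continuous map into the leaf of
`F` through the image of the base point (subspace topology). [folklore] -/
def fillLeafMap (ho : F.IsTransverselyOriented) (y : P.gr.X₀) :
    C((P.datum ho).foliation.leaf y, F.leaf (P.fill P.apex (y : ℝ × ℝ))) where
  toFun k := ⟨P.fill P.apex ((k : P.gr.X₀) : ℝ × ℝ), P.fill_mem_leaf ho k.2⟩
  continuous_toFun := by
    refine Continuous.subtype_mk ?_ _
    have h1 : Continuous fun k : (P.datum ho).foliation.leaf y ↦ ((k : P.gr.X₀) : ℝ × ℝ) :=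
      continuous_subtype_val.comp continuous_subtype_val
    refine (P.continuousOn_fill (m := P.apex)).comp_continuous h1 fun k ↦ ?_
    have hk := ((P.gr.mem_X₀_iff).1 (k : P.gr.X₀).2).1
    rw [← grid_S hL P.hn]
    exact ball_subset_closedBall hk

/-- The value of the filled leaf map. [folklore] -/
@[simp] theorem fillLeafMap_apply (ho : F.IsTransverselyOriented) (y : P.gr.X₀) (k : (P.datum ho).foliation.leaf y) :
    (P.fillLeafMap ho y k : M) = P.fill P.apex ((k : P.gr.X₀) : ℝ × ℝ) := rfl

/-- **The straight-line null-homotopy in box coordinates** of a map into a plaque. For a flow box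
`e` of `F`, a space `K`, a continuous `g : K → M` with values in the plaque of `e` at height `t`,
and a point `k₀`, the map `g` into the leaf of `g k₀` is homotopic to the constant map.
[folklore] -/
theorem homotopic_const_of_mem_plaque {K : Type*} [TopologicalSpace K] {e : OpenPartialHomeomorph M (B × ℝ)}
    (he : e ∈ F.atlas) {t : ℝ} {g : K → M} (hg : Continuous g) (hmem : ∀ k, g k ∈ plaque e t) (k₀ : K)
    (hleaf : ∀ k, g k ∈ F.leaf (g k₀)) :
    ContinuousMap.Homotopic (⟨fun k ↦ ⟨g k, hleaf k⟩, hg.subtype_mk _⟩ : C(K, F.leaf (g k₀)))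
      (ContinuousMap.const K ⟨g k₀, hleaf k₀⟩) := by
  -- the homotopy `(s, k) ↦ e⁻¹ ((1 - s) b(k) + s b(k₀), t)`
  have hsymm : Continuous e.symm := F.continuous_symm_of_mem he
  set Hf : I × K → M := fun p ↦ e.symm ((1 - (p.1 : ℝ)) • (e (g p.2)).1 + (p.1 : ℝ) • (e (g k₀)).1, t) with hHf
  have hHc : Continuous Hf := by
    refine hsymm.comp (Continuous.prodMk ?_ continuous_const)
    have hb : Continuous fun p : I × K ↦ (e (g p.2)).1 :=
      continuous_fst.comp ((e.continuousOn.comp_continuous (hg.comp continuous_snd) fun p ↦ (hmem p.2).1))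
    have hs : Continuous fun p : I × K ↦ ((p.1 : I) : ℝ) := continuous_induced_dom.comp continuous_fst
    exact ((continuous_const.sub hs).smul hb).add (hs.smul continuous_const)
  have hHmem : ∀ p, Hf p ∈ plaque e t := fun p ↦ F.symm_mem_plaque he _ t
  have hHleaf : ∀ p, Hf p ∈ F.leaf (g k₀) := fun p ↦
    F.plaque_subset_leaf_of_mem he (F.mem_leaf_self _) (hmem k₀) (hHmem p)
  refine ⟨{ toFun := fun p ↦ ⟨Hf p, hHleaf p⟩
            continuous_toFun := hHc.subtype_mk _
            map_zero_left := fun k ↦ ?_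
            map_one_left := fun k ↦ ?_ }⟩
  · apply Subtype.ext
    show e.symm ((1 - (0 : ℝ)) • (e (g k)).1 + (0 : ℝ) • (e (g k₀)).1, t) = g k
    rw [sub_zero, one_smul, zero_smul, add_zero, ← (hmem k).2, Prod.mk.eta, e.left_inv (hmem k).1]
  · apply Subtype.ext
    show e.symm ((1 - (1 : ℝ)) • (e (g k)).1 + (1 : ℝ) • (e (g k₀)).1, t) = g k₀
    rw [sub_self, zero_smul, one_smul, zero_add, ← (hmem k₀).2, Prod.mk.eta, e.left_inv (hmem k₀).1]

/-- **The contour circles around a roof centre are null-homotopic in their leaves.** [folklore] -/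
theorem homotopic_const_fillLeafMap_levelSet (ho : F.IsTransverselyOriented) {q : Fin P.n × Fin P.n} {h : ℝ}
    {y : P.gr.X₀} (hy : (y : ℝ × ℝ) ∈ (P.datum ho).levelSet q h) (hr : (P.datum ho).roof q)
    (hlo : ∀ z ∈ sphere (P.gr.centre q) P.gr.ℓ, (P.datum ho).ψ q z < h) (hhi : h < (P.datum ho).m q) :
    (P.fillLeafMap ho y).Homotopic (ContinuousMap.const _ ⟨P.fill P.apex (y : ℝ × ℝ), F.mem_leaf_self _⟩) := by
  have hleaf := (P.datum ho).leaf_eq_levelSet hr hlo hhi hy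
  have hmem : ∀ k : (P.datum ho).foliation.leaf y, P.fill P.apex ((k : P.gr.X₀) : ℝ × ℝ) ∈ plaque (P.box q) h := by
    intro k
    have hk : ((k : P.gr.X₀) : ℝ × ℝ) ∈ (P.datum ho).levelSet q h := by
      have hk2 : (k : P.gr.X₀) ∈ (P.datum ho).foliation.leaf y := k.2
      exact hleaf.le hk2
    exact P.fill_levelSet ho hk
  exact homotopic_const_of_mem_plaque (F := F) (K := (P.datum ho).foliation.leaf y) (P.box_mem q)
    (g := fun k ↦ P.fill P.apex ((k : P.gr.X₀) : ℝ × ℝ))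
    (continuous_subtype_val.comp (P.fillLeafMap ho y).continuous) hmem ⟨y, (P.datum ho).foliation.mem_leaf_self y⟩
    (fun k ↦ P.fill_mem_leaf ho k.2)

/-- **The contour circles around a floor centre are null-homotopic in their leaves.** [folklore] -/
theorem homotopic_const_fillLeafMap_levelSet_floor (ho : F.IsTransverselyOriented) {q : Fin P.n × Fin P.n} {h : ℝ}
    {y : P.gr.X₀} (hy : (y : ℝ × ℝ) ∈ (P.datum ho).levelSet q h) (hr : ¬ (P.datum ho).roof q)
    (hlo : (P.datum ho).m q < h) (hhi : ∀ z ∈ sphere (P.gr.centre q) P.gr.ℓ, h < (P.datum ho).ψ q z) :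
    (P.fillLeafMap ho y).Homotopic (ContinuousMap.const _ ⟨P.fill P.apex (y : ℝ × ℝ), F.mem_leaf_self _⟩) := by
  have hleaf := (P.datum ho).leaf_eq_levelSet_floor hr hlo hhi hy
  have hmem : ∀ k : (P.datum ho).foliation.leaf y, P.fill P.apex ((k : P.gr.X₀) : ℝ × ℝ) ∈ plaque (P.box q) h := by
    intro k
    have hk : ((k : P.gr.X₀) : ℝ × ℝ) ∈ (P.datum ho).levelSet q h := by
      have hk2 : (k : P.gr.X₀) ∈ (P.datum ho).foliation.leaf y := k.2
      exact hleaf.le hk2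
    exact P.fill_levelSet ho hk
  exact homotopic_const_of_mem_plaque (F := F) (K := (P.datum ho).foliation.leaf y) (P.box_mem q)
    (g := fun k ↦ P.fill P.apex ((k : P.gr.X₀) : ℝ × ℝ))
    (continuous_subtype_val.comp (P.fillLeafMap ho y).continuous) hmem ⟨y, (P.datum ho).foliation.mem_leaf_self y⟩
    (fun k ↦ P.fill_mem_leaf ho k.2)

end Foliation.ConePosition

end Literature.Topology.FourManifolds
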